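import Mathlib
import HarnessLib
import Summits.HubbardSuperconductivity.HubbardSuperconductivity.Theorems.KLProgrammeKLRegimeEnginePairTransferDLineEdgePinnedFiveSlot

/-!
# Route `KLProgramme` — ENGINE item stmt-HubbardSuperconductivity-20437 `KLRegimeEngineV17F2`, class #5 rev 3 — «88b» THE PINNED PAIR: the five-slot ADAPTER at EVERY transfer in the
# forward window (zero transfer included) — `dLine_pinned_direct_fiveSlotS'`, `dLine_pinned_crossed_fiveSlotS'`
# (cell gate-hubbard-kl, seat hubbard-kl-k3c1-p1 g17; completes …DLineEdgePinnedFiveSlot, whose rows ask `0 < |x−y|_𝕋` / `0 < |Q_m−x−y|_𝕋`)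

WHY.  The spine's guarded forward rows quantify over ALL `(x, y)` in the window, including the zero-transfer points `x = y` / `x + y = Q_m`; k3c2-p2's
`pinned_row_le_slotsS(_shiftS)` ask `0 < r` only to write `r/Λₙ₊₁` as the ROOM's `min(r/Λₙ₊₁, Λₙ₊₁/r)`.  Since `Λ/0 = 0` in Lean, the identity also holds at `r = 0`
(`klpp_div_eq_min_of_nonneg`), so the slots lemmas hold for `0 ≤ r` (`pinned_row_le_slotsS₀`, `pinned_row_le_slots_shiftS₀`: the original proofs with that one lemma
swapped) and the adapter drops its positivity hypothesis (`…fiveSlotS'`: same five size rows, same conclusion).  Pure composition; nothing asserts (X).3, (c), K3 or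
superconductivity.  0 kit · 0 lit.
-/

noncomputable section

namespace Summit.HubbardSuperconductivity.HubbardSuperconductivity.Theorems.KLRegimeSplit

set_option linter.dupNamespace false -- summit = problem name (single-conjunct summit), D-0017

open Real Set Finset Complex Literature.MathematicalPhysics.QuantumLattice
open Literature.Probability.LatticeModels hiding torusSupNorm
open Literature.MathematicalPhysics.QuantumLattice.BandSectorCounting
open Summit.HubbardSuperconductivity.HubbardSuperconductivity.Theorems.KLProgrammeLegKernels
open Summit.HubbardSuperconductivity.HubbardSuperconductivity.Theorems.KLRegimeWick
open Summit.HubbardSuperconductivity.HubbardSuperconductivity.Theorems.TwoPointAssembly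
open Summit.HubbardSuperconductivity.HubbardSuperconductivity.Theorems.DispersionFlow
open Summit.HubbardSuperconductivity.HubbardSuperconductivity.Theorems.PerturbedFermiCurve

variable {L M : ℕ} [NeZero L] [NeZero M] (β μ : ℝ) (K : TrigPolyC4v)

section AdapterAll

variable {a' b' : ℝ} (B : BandBounds a' b') {R : RenConsts} {U : ℝ} {N : ℕ} {A : ℝ}

/-! ## §0 The transfer monomial at nonnegative transfer (zero included: `Λ/0 = 0` makes both sides vanish) -/

omit [NeZero L] [NeZero M] in
/-- `0 ≤ r ≤ Λ₁` ⇒ `r/Λ₁ = min(r/Λ₁, Λ₁/r)` (at `r = 0` both sides are `0`). -/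
theorem klpp_div_eq_min_of_nonneg {r Λ₁ : ℝ} (hr : 0 ≤ r) (hrΛ : r ≤ Λ₁) : r / Λ₁ = min (r / Λ₁) (Λ₁ / r) := by
  rcases hr.eq_or_lt with h0 | hpos
  · rw [← h0]; simp
  · exact div_eq_min_of_le hpos hrΛ

omit [NeZero M] in
/-- `pinned_row_le_slotsS` (k3c2-p2 g22) with `0 ≤ r` (zero transfer included). -/
theorem pinned_row_le_slotsS₀ {d A G A₀ La : ℝ} (hdA : 0 < d - 4 * A) (hA : 0 ≤ A) (hA0 : 0 ≤ A₀) (hLa : 0 ≤ La)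
    (hβ : klBetaMin ≤ β) {n : ℕ} (hn : n ≤ nScales β) {r : ℝ} (hr : 0 ≤ r) (hrΛ : r ≤ klScale klE0 (n + 1)) :
    2 * ((klScale klE0 n - klScale klE0 (n + 1)) * klmsRowBoundS d A G A₀ La β n (n + 2) (G * r) L) ≤
      3 / π * (64 / Real.pi * 8 *
              (Real.pi * Real.sqrt 2 / (d - 4 * A) * (2 * La + 2 * A₀ * (2 / (1 / 10))) / (d - 4 * A) +
                2 * A₀ * (1 / (d - 4 * A) ^ 2 + Real.pi * Real.sqrt 2 * (2 + 4 * A) / (d - 4 * A) ^ 3))) *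
          klE0 * ((4 : ℝ) ^ (n + 1))⁻¹ +
        12 / π * (393216 / Real.pi * (64 * 16 + (2 * (448 / 3 * Real.exp 2) + 8) + 64) * (2 * A₀ * (Real.pi * Real.sqrt 2 / (d - 4 * A)))) *
          ((4 : ℝ) ^ (nScales β - n))⁻¹ +
        3 / π * (256 / Real.pi * 8 * (2 * A₀ * (Real.pi * Real.sqrt 2 / (d - 4 * A))) * (65 * (8 * (16 : ℝ)) + 17408 / 3 * 1)) *
          (G * min (r / klScale klE0 (n + 1)) (klScale klE0 (n + 1) / r)) +
        2 * (96 * (512 * La / klScale klE0 (n + 1) +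
            32 * A₀ * G * ((9 * (2 * (448 / 3 * Real.exp 2) + 8) + 4 * 8) + (65 * (8 * (16 : ℝ)) + 17408 / 3 * 1)) /
              klScale klE0 (n + 1) ^ 2) / L) := by
  have hπ := Real.pi_pos
  have hβ0 : 0 < β := lt_of_lt_of_le (by norm_num [klBetaMin]) hβ
  have hΛ1 := klth_klScale_pos (n + 1)
  rw [pinned_rowBound_readingS]
  -- abbreviate the closed constants
  set ZS : ℝ := 64 / Real.pi * 8 *
      (Real.pi * Real.sqrt 2 / (d - 4 * A) * (2 * La + 2 * A₀ * (2 / (1 / 10))) / (d - 4 * A) +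
        2 * A₀ * (1 / (d - 4 * A) ^ 2 + Real.pi * Real.sqrt 2 * (2 + 4 * A) / (d - 4 * A) ^ 3)) with hZS
  set TH : ℝ := 393216 / Real.pi * (64 * 16 + (2 * (448 / 3 * Real.exp 2) + 8) + 64) * (2 * A₀ * (Real.pi * Real.sqrt 2 / (d - 4 * A))) with hTH
  set TR : ℝ := 256 / Real.pi * 8 * (2 * A₀ * (Real.pi * Real.sqrt 2 / (d - 4 * A))) * (65 * (8 * (16 : ℝ)) + 17408 / 3 * 1) with hTR
  set LAT : ℝ := 96 * (512 * La / klScale klE0 (n + 1) +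
      32 * A₀ * G * ((9 * (2 * (448 / 3 * Real.exp 2) + 8) + 4 * 8) + (65 * (8 * (16 : ℝ)) + 17408 / 3 * 1)) / klScale klE0 (n + 1) ^ 2) with hLAT
  obtain ⟨hZS0, hTH0, hTR0⟩ : 0 ≤ ZS ∧ 0 ≤ TH ∧ 0 ≤ TR := ⟨by rw [hZS]; positivity, by rw [hTH]; positivity, by rw [hTR]; positivity⟩
  -- the three dictionary lines
  have hΛeq : klScale klE0 (n + 1) = klE0 * ((4 : ℝ) ^ (n + 1))⁻¹ := rfl
  have hth := klmsRoom_thermal_le hβ hn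
  have hmin : (|(0 : ℝ)| + G * r) / klScale klE0 (n + 1) = G * min (r / klScale klE0 (n + 1)) (klScale klE0 (n + 1) / r) := by
    rw [← klpp_div_eq_min_of_nonneg hr hrΛ, abs_zero, zero_add, mul_div_assoc]
  rw [hmin]
  have h1 : 3 / (2 * π) * (ZS * klScale klE0 (n + 1)) = 1 / 2 * (3 / π * ZS * klE0 * ((4 : ℝ) ^ (n + 1))⁻¹) := by rw [hΛeq]; ring
  have h2 : 3 / (2 * π) * (TH * ((Real.pi / β) / klScale klE0 (n + 1))) ≤ 1 / 2 * (12 / π * TH * ((4 : ℝ) ^ (nScales β - n))⁻¹) := by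
    have := mul_le_mul_of_nonneg_left hth (by positivity : 0 ≤ 3 / (2 * π) * TH)
    calc 3 / (2 * π) * (TH * ((Real.pi / β) / klScale klE0 (n + 1))) = 3 / (2 * π) * TH * ((Real.pi / β) / klScale klE0 (n + 1)) := by ring
      _ ≤ 3 / (2 * π) * TH * (4 * ((4 : ℝ) ^ (nScales β - n))⁻¹) := this
      _ = 1 / 2 * (12 / π * TH * ((4 : ℝ) ^ (nScales β - n))⁻¹) := by ring
  have h3 : 3 / (2 * π) * (TR * (G * min (r / klScale klE0 (n + 1)) (klScale klE0 (n + 1) / r))) =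
      1 / 2 * (3 / π * TR * (G * min (r / klScale klE0 (n + 1)) (klScale klE0 (n + 1) / r))) := by ring
  have hsplit : 3 / (2 * π) * (ZS * klScale klE0 (n + 1) + TH * ((Real.pi / β) / klScale klE0 (n + 1)) + TR * (G * min (r / klScale klE0 (n + 1)) (klScale klE0 (n + 1) / r))) =
      3 / (2 * π) * (ZS * klScale klE0 (n + 1)) + 3 / (2 * π) * (TH * ((Real.pi / β) / klScale klE0 (n + 1))) +
        3 / (2 * π) * (TR * (G * min (r / klScale klE0 (n + 1)) (klScale klE0 (n + 1) / r))) := by ring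
  rw [hsplit, h1, h3]
  linarith

omit [NeZero M] in
/-- `pinned_row_le_slots_shiftS` (k3c2-p2 g22) with `0 ≤ r` (zero transfer included). -/
theorem pinned_row_le_slots_shiftS₀ {d A G A₀ La : ℝ} (hdA : 0 < d - 4 * A) (hA : 0 ≤ A) (hG : 0 ≤ G) (hA0 : 0 ≤ A₀) (hLa : 0 ≤ La)
    (hβ : klBetaMin ≤ β) {n : ℕ} (hn : n ≤ nScales β) {r : ℝ} (hr : 0 ≤ r) (hrΛ : r ≤ klScale klE0 (n + 1)) {s : ℝ} (hs : |s| = 2 * π / β) :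
    2 * ((klScale klE0 n - klScale klE0 (n + 1)) * klmsRowBoundS d A G A₀ La β n (n + 2) (|s| + G * r) L) ≤
      3 / π * (64 / Real.pi * 8 *
              (Real.pi * Real.sqrt 2 / (d - 4 * A) * (2 * La + 2 * A₀ * (2 / (1 / 10))) / (d - 4 * A) +
                2 * A₀ * (1 / (d - 4 * A) ^ 2 + Real.pi * Real.sqrt 2 * (2 + 4 * A) / (d - 4 * A) ^ 3))) *
          klE0 * ((4 : ℝ) ^ (n + 1))⁻¹ +
        12 / π * (393216 / Real.pi * (64 * 16 + (2 * (448 / 3 * Real.exp 2) + 8) + 64) * (2 * A₀ * (Real.pi * Real.sqrt 2 / (d - 4 * A))) +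
            2 * (256 / Real.pi * 8 * (2 * A₀ * (Real.pi * Real.sqrt 2 / (d - 4 * A))) * (65 * (8 * (16 : ℝ)) + 17408 / 3 * 1))) *
          ((4 : ℝ) ^ (nScales β - n))⁻¹ +
        3 / π * (256 / Real.pi * 8 * (2 * A₀ * (Real.pi * Real.sqrt 2 / (d - 4 * A))) * (65 * (8 * (16 : ℝ)) + 17408 / 3 * 1)) *
          (G * min (r / klScale klE0 (n + 1)) (klScale klE0 (n + 1) / r)) +
        2 * (96 * (512 * La / klScale klE0 (n + 1) +
            32 * A₀ * G * ((9 * (2 * (448 / 3 * Real.exp 2) + 8) + 4 * 8) + (65 * (8 * (16 : ℝ)) + 17408 / 3 * 1)) /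
              klScale klE0 (n + 1) ^ 2) / L) := by
  have hπ := Real.pi_pos
  have hβ0 : 0 < β := lt_of_lt_of_le (by norm_num [klBetaMin]) hβ
  have hΛ1 := klth_klScale_pos (n + 1)
  rw [pinned_rowBound_readingS, hs]
  set ZS : ℝ := 64 / Real.pi * 8 *
      (Real.pi * Real.sqrt 2 / (d - 4 * A) * (2 * La + 2 * A₀ * (2 / (1 / 10))) / (d - 4 * A) +
        2 * A₀ * (1 / (d - 4 * A) ^ 2 + Real.pi * Real.sqrt 2 * (2 + 4 * A) / (d - 4 * A) ^ 3)) with hZS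
  set TH : ℝ := 393216 / Real.pi * (64 * 16 + (2 * (448 / 3 * Real.exp 2) + 8) + 64) * (2 * A₀ * (Real.pi * Real.sqrt 2 / (d - 4 * A))) with hTH
  set TR : ℝ := 256 / Real.pi * 8 * (2 * A₀ * (Real.pi * Real.sqrt 2 / (d - 4 * A))) * (65 * (8 * (16 : ℝ)) + 17408 / 3 * 1) with hTR
  set LAT : ℝ := 96 * (512 * La / klScale klE0 (n + 1) +
      32 * A₀ * G * ((9 * (2 * (448 / 3 * Real.exp 2) + 8) + 4 * 8) + (65 * (8 * (16 : ℝ)) + 17408 / 3 * 1)) / klScale klE0 (n + 1) ^ 2) with hLAT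
  obtain ⟨hZS0, hTH0, hTR0⟩ : 0 ≤ ZS ∧ 0 ≤ TH ∧ 0 ≤ TR := ⟨by rw [hZS]; positivity, by rw [hTH]; positivity, by rw [hTR]; positivity⟩
  have hΛeq : klScale klE0 (n + 1) = klE0 * ((4 : ℝ) ^ (n + 1))⁻¹ := rfl
  have hth := klmsRoom_thermal_le hβ hn
  set q : ℝ := ((4 : ℝ) ^ (nScales β - n))⁻¹ with hq
  set mn : ℝ := min (r / klScale klE0 (n + 1)) (klScale klE0 (n + 1) / r) with hmn
  have hsplit : (|(0 : ℝ)| + (2 * π / β + G * r)) / klScale klE0 (n + 1) = 2 * ((Real.pi / β) / klScale klE0 (n + 1)) + G * mn := by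
    rw [hmn, ← klpp_div_eq_min_of_nonneg hr hrΛ, abs_zero, zero_add]
    field_simp
  rw [hsplit]
  have h1 : 3 / (2 * π) * (ZS * klScale klE0 (n + 1)) = 1 / 2 * (3 / π * ZS * klE0 * ((4 : ℝ) ^ (n + 1))⁻¹) := by rw [hΛeq]; ring
  have hth' : (Real.pi / β) / klScale klE0 (n + 1) ≤ 4 * q := hth
  have hth0 : 0 ≤ (Real.pi / β) / klScale klE0 (n + 1) := by positivity
  have hmn0 : 0 ≤ mn := by rw [hmn]; exact le_min (by positivity) (by positivity)
  have h2 : 3 / (2 * π) * (TH * ((Real.pi / β) / klScale klE0 (n + 1))) ≤ 1 / 2 * (12 / π * TH * q) := by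
    have := mul_le_mul_of_nonneg_left hth' (by positivity : 0 ≤ 3 / (2 * π) * TH)
    calc 3 / (2 * π) * (TH * ((Real.pi / β) / klScale klE0 (n + 1))) = 3 / (2 * π) * TH * ((Real.pi / β) / klScale klE0 (n + 1)) := by ring
      _ ≤ 3 / (2 * π) * TH * (4 * q) := this
      _ = 1 / 2 * (12 / π * TH * q) := by ring
  have h3 : 3 / (2 * π) * (TR * (2 * ((Real.pi / β) / klScale klE0 (n + 1)) + G * mn)) ≤ 1 / 2 * (12 / π * (2 * TR) * q) + 1 / 2 * (3 / π * TR * (G * mn)) := by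
    have := mul_le_mul_of_nonneg_left hth' (by positivity : 0 ≤ 3 / (2 * π) * TR * 2)
    calc 3 / (2 * π) * (TR * (2 * ((Real.pi / β) / klScale klE0 (n + 1)) + G * mn))
        = 3 / (2 * π) * TR * 2 * ((Real.pi / β) / klScale klE0 (n + 1)) + 1 / 2 * (3 / π * TR * (G * mn)) := by ring
      _ ≤ 3 / (2 * π) * TR * 2 * (4 * q) + 1 / 2 * (3 / π * TR * (G * mn)) := by linarith
      _ = 1 / 2 * (12 / π * (2 * TR) * q) + 1 / 2 * (3 / π * TR * (G * mn)) := by ring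
  have hsum : 3 / (2 * π) * (ZS * klScale klE0 (n + 1) + TH * ((Real.pi / β) / klScale klE0 (n + 1)) + TR * (2 * ((Real.pi / β) / klScale klE0 (n + 1)) + G * mn)) =
      3 / (2 * π) * (ZS * klScale klE0 (n + 1)) + 3 / (2 * π) * (TH * ((Real.pi / β) / klScale klE0 (n + 1))) +
        3 / (2 * π) * (TR * (2 * ((Real.pi / β) / klScale klE0 (n + 1)) + G * mn)) := by ring
  rw [hsum, h1]
  have e12 : 12 / π * (TH + 2 * TR) * q = 12 / π * TH * q + 12 / π * (2 * TR) * q := by ring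
  rw [e12]
  linarith

set_option maxHeartbeats 1600000 in
/-- **THE PINNED PAIR's DIRECT `D`-ROW IN FIVE-SLOT FORM, any transfer in the window** (module docstring). -/
theorem dLine_pinned_direct_fiveSlotS' (hR : ∀ j, 0 ≤ R.Gfr j) (hK : FrameOK R U N μ K)
    (hAb : ∀ p : Momentum, ∀ j ≤ 2, ‖iteratedFDeriv ℝ j (frameShift K) p‖ ≤ A) (hA : 4 * A < B.Dtmin) (hA20 : 4 * A ≤ 1 / 20) (hμ : μ ≤ -0.15)
    (n : ℕ) {t : ℝ} (ht : t ∈ Icc (0 : ℝ) 1) (hβ : klBetaMin ≤ β) (hβL : β ≤ L) (hn : n + 1 ≤ nScales β + 1)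
    (hM : β * (4 * klScale klE0 (n + 1)) / (2 * Real.pi) + 1 ≤ M)
    (Wd : ℝ → FreqMomentum L M → ℝ) (hWd : Wd = fun t k => deriv (fun Λ' : ℝ => hubbardCutoffWeightCT L M β μ K Λ' k) (klScale klE0 n + t * (klScale klE0 (n + 1) - klScale klE0 n)))
    (V : ℕ → ℝ → (Fin 4 → HubbardFieldIdx L M) → ℂ) {j : ℕ} (hj : n + 2 ≤ j) (Qm x y : TorusSite 2 L)
    (hlo : a' < μ - 4 * klScale klE0 (n + 1) - 4 * A) (hhi : μ + 4 * klScale klE0 (n + 1) + 4 * A < b')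
    (hq : (4 + 8 / 3 * R.Gfr 1 * U ^ 2) * klTorusNorm L (x - y) ≤ klScale klE0 (n + 1) / 8)
    (c : ℂ) (F₁ F₂ : FreqMomentum L M → Fin 2 → FreqMomentum L M → ℂ) (F₁₀ : TorusSite 2 L → Fin 2 → TorusSite 2 L → ℂ)
    (hsplit : ∀ (p : FreqMomentum L M) (σ : Fin 2) (p' : FreqMomentum L M),
      V j t ![((p, σ), 1), ((p', σ), 0), (((omega0 M, y), 0), 0), (((omega0 M, x), 0), 1)] *
          V j t ![((p, σ), 0), ((p', σ), 1), ((((omega0 M).rev, Qm - y), 1), 0), ((((omega0 M).rev, Qm - x), 1), 1)] = c + F₁ p σ p' + F₂ p σ p')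
    {A₁ L₁ ε₁ : ℝ} (hA1 : 0 ≤ A₁) (hL1 : 0 ≤ L₁) (hε1 : 0 ≤ ε₁)
    (hY0p₁ : ∀ k : TorusSite 2 L, ‖∑ σ : Fin 2, F₁₀ k σ (k + (x - y))‖ ≤ A₁)
    (hY1p₁ : ∀ k k' : TorusSite 2 L, ‖(∑ σ : Fin 2, F₁₀ k σ (k + (x - y))) - ∑ σ : Fin 2, F₁₀ k' σ (k' + (x - y))‖ ≤ L₁ * klTorusNorm L (k - k'))
    (hY0m₁ : ∀ k : TorusSite 2 L, ‖∑ σ : Fin 2, F₁₀ (k + -(x - y)) σ k‖ ≤ A₁)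
    (hY1m₁ : ∀ k k' : TorusSite 2 L, ‖(∑ σ : Fin 2, F₁₀ (k + -(x - y)) σ k) - ∑ σ : Fin 2, F₁₀ (k' + -(x - y)) σ k'‖ ≤ L₁ * klTorusNorm L (k - k'))
    (hflat₁ : ∀ (i : MatsubaraIdx M) (σ : Fin 2) (k k' : TorusSite 2 L), matsubaraFreq β M i ^ 2 ≤ (4 * klScale klE0 (n + 1)) ^ 2 →
      ‖F₁ (i, k) σ (i, k') - F₁₀ k σ k'‖ ≤ ε₁)
    (cen : TorusSite 2 L) {ρ A₂ : ℝ} (hρ : 0 ≤ ρ) (hA2 : 0 ≤ A₂)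
    (hF₂ : ∀ (p : FreqMomentum L M) (σ : Fin 2) (p' : FreqMomentum L M), ‖F₂ p σ p'‖ ≤ A₂)
    (hsupp₂ : ∀ (p : FreqMomentum L M) (σ : Fin 2) (p' : FreqMomentum L M), ρ < klTorusNorm L (p.2 - cen) → F₂ p σ p' = 0)
    {P : SplitConsts} {zD hD wD lD tD : ℝ}
    (hz : 3 / π * (64 / Real.pi * 8 * (Real.pi * Real.sqrt 2 / (B.Dtmin - 4 * A) * (2 * L₁ + 2 * (2 * ‖c‖ + A₁) * (2 / (1 / 10))) / (B.Dtmin - 4 * A) + 2 * (2 * ‖c‖ + A₁) * (1 / (B.Dtmin - 4 * A) ^ 2 + Real.pi * Real.sqrt 2 * (2 + 4 * A) / (B.Dtmin - 4 * A) ^ 3))) *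
          klE0 * ((4 : ℝ) ^ (n + 1))⁻¹ + A₂ * (1024 * 15381) * (ρ / π) ≤ (P.Klam * U) ^ 2 * zD * ((4 : ℝ) ^ (n + 1))⁻¹)
    (hh : 12 / π * (393216 / Real.pi * (64 * 16 + (2 * (448 / 3 * Real.exp 2) + 8) + 64) * (2 * (2 * ‖c‖ + A₁) * (Real.pi * Real.sqrt 2 / (B.Dtmin - 4 * A)))) *
          ((4 : ℝ) ^ (nScales β - n))⁻¹ ≤ (P.Klam * U) ^ 2 * hD * ((4 : ℝ) ^ (nScales β - n))⁻¹)
    (hw : ε₁ * (512 * 15367) ≤ (P.Klam * U) ^ 2 * wD * ((2 : ℝ) ^ n)⁻¹)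
    (hl : 2 * (96 * (512 * L₁ / klScale klE0 (n + 1) + 32 * (2 * ‖c‖ + A₁) * (4 + 8 / 3 * R.Gfr 1 * U ^ 2) * ((9 * (2 * (448 / 3 * Real.exp 2) + 8) + 4 * 8) + (65 * (8 * (16 : ℝ)) + 17408 / 3 * 1)) / klScale klE0 (n + 1) ^ 2) / L) + A₂ * (1024 * 15381) * ((L : ℝ))⁻¹ ≤ (P.Klam * U) ^ 2 * lD * ((L : ℝ))⁻¹)
    (htt : 3 / π * (256 / Real.pi * 8 * (2 * (2 * ‖c‖ + A₁) * (Real.pi * Real.sqrt 2 / (B.Dtmin - 4 * A))) * (65 * (8 * (16 : ℝ)) + 17408 / 3 * 1)) *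
          ((4 + 8 / 3 * R.Gfr 1 * U ^ 2) * min (klTorusNorm L (x - y) / klScale klE0 (n + 1)) (klScale klE0 (n + 1) / klTorusNorm L (x - y))) ≤ (P.Klam * U) ^ 2 * tD * min (klTorusNorm L (x - y) / klScale klE0 (n + 1)) (klScale klE0 (n + 1) / klTorusNorm L (x - y))) :
    (klScale klE0 n - klScale klE0 (n + 1)) * ((β * (L : ℝ) ^ 2) ^ 3)⁻¹ *
        ‖∑ p : FreqMomentum L M, ∑ σ : Fin 2, ∑ p' : FreqMomentum L M,
          if matsubaraInt M p'.1 + matsubaraInt M (omega0 M) = matsubaraInt M p.1 + matsubaraInt M (omega0 M) ∧ p'.2 = p.2 + x - y then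
            ((((((softSymbolCompl L M β μ K (n + 1) j p - softSymbolCompl L M β μ K (n + 1) (n + 1) p) : ℝ) : ℂ) * (((β * (L : ℝ) ^ 2 : ℝ) : ℂ) * propCT L M β μ K p)) *
                  ((((Wd t p') : ℝ) : ℂ) * (((β * (L : ℝ) ^ 2 : ℝ) : ℂ) * propCT L M β μ K p'))) +
                (((((Wd t p) : ℝ) : ℂ) * (((β * (L : ℝ) ^ 2 : ℝ) : ℂ) * propCT L M β μ K p)) *
                  ((((softSymbolCompl L M β μ K (n + 1) j p' - softSymbolCompl L M β μ K (n + 1) (n + 1) p') : ℝ) : ℂ) * (((β * (L : ℝ) ^ 2 : ℝ) : ℂ) * propCT L M β μ K p')))) *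
              (V j t ![((p, σ), 1), ((p', σ), 0), (((omega0 M, y), 0), 0), (((omega0 M, x), 0), 1)] *
                V j t ![((p, σ), 0), ((p', σ), 1), ((((omega0 M).rev, Qm - y), 1), 0), ((((omega0 M).rev, Qm - x), 1), 1)])
          else 0‖ ≤
      (P.Klam * U) ^ 2 * (zD * ((4 : ℝ) ^ (n + 1))⁻¹ + hD * ((4 : ℝ) ^ (nScales β - n))⁻¹ + wD * ((2 : ℝ) ^ n)⁻¹ + lD * ((L : ℝ))⁻¹ + tD * min (klTorusNorm L (x - y) / klScale klE0 (n + 1)) (klScale klE0 (n + 1) / klTorusNorm L (x - y))) := by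
  have hβ0 : 0 < β := lt_of_lt_of_le (by norm_num [klBetaMin]) hβ
  have hdoor := dLine_pinned_direct_split3_doorS β μ K B hR hK hAb hA hA20 hμ n ht hβ hβL hn hM Wd hWd V hj Qm x y hlo hhi hq c F₁ F₂ F₁₀ hsplit
    hA1 hL1 hε1 hY0p₁ hY1p₁ hY0m₁ hY1m₁ hflat₁ cen hρ hA2 hF₂ hsupp₂
  rw [klpp_rowS_two_add, zero_add] at hdoor
  have hr0 : 0 ≤ klTorusNorm L (x - y) := torusSupNorm_nonneg _
  have hA0 : 0 ≤ A := (norm_nonneg _).trans (hAb 0 0 (by norm_num))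
  have hdA : 0 < B.Dtmin - 4 * A := by linarith only [hA]
  have hnβ : n ≤ nScales β := by omega
  have hGfr : 0 ≤ R.Gfr 1 := hR 1
  have hG4 : 4 ≤ (4 + 8 / 3 * R.Gfr 1 * U ^ 2) := by nlinarith [sq_nonneg U]
  have hrΛ : klTorusNorm L (x - y) ≤ klScale klE0 (n + 1) := by
    have h4 := mul_le_mul_of_nonneg_right hG4 hr0
    linarith only [hq, h4, klth_klScale_pos (n + 1)]
  have hslots := pinned_row_le_slotsS₀ (L := L) (β := β) (G := (4 + 8 / 3 * R.Gfr 1 * U ^ 2)) hdA hA0 (by positivity : (0 : ℝ) ≤ 2 * ‖c‖ + A₁) hL1 hβ hnβ hr0 hrΛ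
  have e5 : (P.Klam * U) ^ 2 * (zD * ((4 : ℝ) ^ (n + 1))⁻¹ + hD * ((4 : ℝ) ^ (nScales β - n))⁻¹ + wD * ((2 : ℝ) ^ n)⁻¹ + lD * ((L : ℝ))⁻¹ + tD * min (klTorusNorm L (x - y) / klScale klE0 (n + 1)) (klScale klE0 (n + 1) / klTorusNorm L (x - y))) =
      (P.Klam * U) ^ 2 * zD * ((4 : ℝ) ^ (n + 1))⁻¹ + (P.Klam * U) ^ 2 * hD * ((4 : ℝ) ^ (nScales β - n))⁻¹ + (P.Klam * U) ^ 2 * wD * ((2 : ℝ) ^ n)⁻¹ +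
        (P.Klam * U) ^ 2 * lD * ((L : ℝ))⁻¹ + (P.Klam * U) ^ 2 * tD * min (klTorusNorm L (x - y) / klScale klE0 (n + 1)) (klScale klE0 (n + 1) / klTorusNorm L (x - y)) := by ring
  rw [e5]
  have eW : A₂ * (1024 * 15381) * (ρ / π + ((L : ℝ))⁻¹) = A₂ * (1024 * 15381) * (ρ / π) + A₂ * (1024 * 15381) * ((L : ℝ))⁻¹ := by ring
  linarith only [hdoor, hslots, hz, hh, hw, hl, htt, eW]

set_option maxHeartbeats 1600000 in
/-- **THE PINNED PAIR's CROSSED `D`-ROW IN FIVE-SLOT FORM, any transfer in the window** (module docstring). -/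
theorem dLine_pinned_crossed_fiveSlotS' (hR : ∀ j, 0 ≤ R.Gfr j) (hK : FrameOK R U N μ K)
    (hAb : ∀ p : Momentum, ∀ j ≤ 2, ‖iteratedFDeriv ℝ j (frameShift K) p‖ ≤ A) (hA : 4 * A < B.Dtmin) (hA20 : 4 * A ≤ 1 / 20) (hμ : μ ≤ -0.15)
    (n : ℕ) {t : ℝ} (ht : t ∈ Icc (0 : ℝ) 1) (hβ : klBetaMin ≤ β) (hβL : β ≤ L) (hn : n + 1 ≤ nScales β + 1) (hβn : 16 * π / β ≤ klScale klE0 (n + 1))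
    (hM : β * (4 * klScale klE0 (n + 1)) / (2 * Real.pi) + 1 ≤ M)
    (Wd : ℝ → FreqMomentum L M → ℝ) (hWd : Wd = fun t k => deriv (fun Λ' : ℝ => hubbardCutoffWeightCT L M β μ K Λ' k) (klScale klE0 n + t * (klScale klE0 (n + 1) - klScale klE0 n)))
    (V : ℕ → ℝ → (Fin 4 → HubbardFieldIdx L M) → ℂ) {j : ℕ} (hj : n + 2 ≤ j) (Qm x y : TorusSite 2 L)
    (hlo : a' < μ - 4 * klScale klE0 (n + 1) - 4 * A) (hhi : μ + 4 * klScale klE0 (n + 1) + 4 * A < b')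
    (hq : (4 + 8 / 3 * R.Gfr 1 * U ^ 2) * klTorusNorm L (Qm - x - y) ≤ klScale klE0 (n + 1) / 16)
    (c : ℂ) (F₁ F₂ : FreqMomentum L M → FreqMomentum L M → ℂ) (F₁₀ : TorusSite 2 L → TorusSite 2 L → ℂ)
    (hsplit : ∀ (p p' : FreqMomentum L M),
      V j t ![((p, 0), 1), ((p', 1), 0), (((omega0 M, y), 0), 0), ((((omega0 M).rev, Qm - x), 1), 1)] *
          V j t ![((p, 0), 0), ((p', 1), 1), ((((omega0 M).rev, Qm - y), 1), 0), (((omega0 M, x), 0), 1)] = c + F₁ p p' + F₂ p p')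
    {A₁ L₁ ε₁ : ℝ} (hA1 : 0 ≤ A₁) (hL1 : 0 ≤ L₁) (hε1 : 0 ≤ ε₁)
    (hY0B₁ : ∀ k : TorusSite 2 L, ‖F₁₀ k (k + (Qm - x - y))‖ ≤ A₁)
    (hY1B₁ : ∀ k k' : TorusSite 2 L, ‖F₁₀ k (k + (Qm - x - y)) - F₁₀ k' (k' + (Qm - x - y))‖ ≤ L₁ * klTorusNorm L (k - k'))
    (hY0A₁ : ∀ k : TorusSite 2 L, ‖F₁₀ (k + -(Qm - x - y)) k‖ ≤ A₁)
    (hY1A₁ : ∀ k k' : TorusSite 2 L, ‖F₁₀ (k + -(Qm - x - y)) k - F₁₀ (k' + -(Qm - x - y)) k'‖ ≤ L₁ * klTorusNorm L (k - k'))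
    (hflat₁ : ∀ (i i' : MatsubaraIdx M) (k k' : TorusSite 2 L), matsubaraInt M i' + 1 = matsubaraInt M i →
      matsubaraFreq β M i ^ 2 ≤ (5 * klScale klE0 (n + 1)) ^ 2 → ‖F₁ (i, k) (i', k') - F₁₀ k k'‖ ≤ ε₁)
    (cen : TorusSite 2 L) {ρ A₂ : ℝ} (hρ : 0 ≤ ρ) (hA2 : 0 ≤ A₂)
    (hF₂ : ∀ (p p' : FreqMomentum L M), ‖F₂ p p'‖ ≤ A₂)
    (hsupp₂ : ∀ (p p' : FreqMomentum L M), ρ < klTorusNorm L (p.2 - cen) → F₂ p p' = 0)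
    {P : SplitConsts} {zX hX wX lX tX : ℝ}
    (hz : 3 / π * (64 / Real.pi * 8 * (Real.pi * Real.sqrt 2 / (B.Dtmin - 4 * A) * (2 * L₁ + 2 * (‖c‖ + A₁) * (2 / (1 / 10))) / (B.Dtmin - 4 * A) + 2 * (‖c‖ + A₁) * (1 / (B.Dtmin - 4 * A) ^ 2 + Real.pi * Real.sqrt 2 * (2 + 4 * A) / (B.Dtmin - 4 * A) ^ 3))) *
          klE0 * ((4 : ℝ) ^ (n + 1))⁻¹ + A₂ * (1024 * 15381) * (ρ / π) ≤ (P.Klam * U) ^ 2 * zX * ((4 : ℝ) ^ (n + 1))⁻¹)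
    (hh : 12 / π * (393216 / Real.pi * (64 * 16 + (2 * (448 / 3 * Real.exp 2) + 8) + 64) * (2 * (‖c‖ + A₁) * (Real.pi * Real.sqrt 2 / (B.Dtmin - 4 * A))) +
            2 * (256 / Real.pi * 8 * (2 * (‖c‖ + A₁) * (Real.pi * Real.sqrt 2 / (B.Dtmin - 4 * A))) * (65 * (8 * (16 : ℝ)) + 17408 / 3 * 1))) *
          ((4 : ℝ) ^ (nScales β - n))⁻¹ ≤ (P.Klam * U) ^ 2 * hX * ((4 : ℝ) ^ (nScales β - n))⁻¹)
    (hw : ε₁ * (512 * 15367) ≤ (P.Klam * U) ^ 2 * wX * ((2 : ℝ) ^ n)⁻¹)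
    (hl : 2 * (96 * (512 * L₁ / klScale klE0 (n + 1) + 32 * (‖c‖ + A₁) * (4 + 8 / 3 * R.Gfr 1 * U ^ 2) * ((9 * (2 * (448 / 3 * Real.exp 2) + 8) + 4 * 8) + (65 * (8 * (16 : ℝ)) + 17408 / 3 * 1)) / klScale klE0 (n + 1) ^ 2) / L) + A₂ * (1024 * 15381) * ((L : ℝ))⁻¹ ≤ (P.Klam * U) ^ 2 * lX * ((L : ℝ))⁻¹)
    (htt : 3 / π * (256 / Real.pi * 8 * (2 * (‖c‖ + A₁) * (Real.pi * Real.sqrt 2 / (B.Dtmin - 4 * A))) * (65 * (8 * (16 : ℝ)) + 17408 / 3 * 1)) *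
          ((4 + 8 / 3 * R.Gfr 1 * U ^ 2) * min (klTorusNorm L (Qm - x - y) / klScale klE0 (n + 1)) (klScale klE0 (n + 1) / klTorusNorm L (Qm - x - y))) ≤ (P.Klam * U) ^ 2 * tX * min (klTorusNorm L (Qm - x - y) / klScale klE0 (n + 1)) (klScale klE0 (n + 1) / klTorusNorm L (Qm - x - y))) :
    (klScale klE0 n - klScale klE0 (n + 1)) * ((β * (L : ℝ) ^ 2) ^ 3)⁻¹ *
        ‖∑ p : FreqMomentum L M, ∑ p' : FreqMomentum L M,
          if matsubaraInt M p'.1 + matsubaraInt M (omega0 M) + matsubaraInt M (omega0 M) + 1 = matsubaraInt M p.1 ∧ p'.2 = p.2 + Qm - x - y then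
            ((((((softSymbolCompl L M β μ K (n + 1) j p - softSymbolCompl L M β μ K (n + 1) (n + 1) p) : ℝ) : ℂ) * (((β * (L : ℝ) ^ 2 : ℝ) : ℂ) * propCT L M β μ K p)) *
                  ((((Wd t p') : ℝ) : ℂ) * (((β * (L : ℝ) ^ 2 : ℝ) : ℂ) * propCT L M β μ K p'))) +
                (((((Wd t p) : ℝ) : ℂ) * (((β * (L : ℝ) ^ 2 : ℝ) : ℂ) * propCT L M β μ K p)) *
                  ((((softSymbolCompl L M β μ K (n + 1) j p' - softSymbolCompl L M β μ K (n + 1) (n + 1) p') : ℝ) : ℂ) * (((β * (L : ℝ) ^ 2 : ℝ) : ℂ) * propCT L M β μ K p')))) *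
              (V j t ![((p, 0), 1), ((p', 1), 0), (((omega0 M, y), 0), 0), ((((omega0 M).rev, Qm - x), 1), 1)] *
                V j t ![((p, 0), 0), ((p', 1), 1), ((((omega0 M).rev, Qm - y), 1), 0), (((omega0 M, x), 0), 1)])
          else 0‖ ≤
      (P.Klam * U) ^ 2 * (zX * ((4 : ℝ) ^ (n + 1))⁻¹ + hX * ((4 : ℝ) ^ (nScales β - n))⁻¹ + wX * ((2 : ℝ) ^ n)⁻¹ + lX * ((L : ℝ))⁻¹ + tX * min (klTorusNorm L (Qm - x - y) / klScale klE0 (n + 1)) (klScale klE0 (n + 1) / klTorusNorm L (Qm - x - y))) := by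
  have hβ0 : 0 < β := lt_of_lt_of_le (by norm_num [klBetaMin]) hβ
  have hdoor := dLine_pinned_crossed_split3_doorS β μ K B hR hK hAb hA hA20 hμ n ht hβ hβL hn hβn hM Wd hWd V hj Qm x y hlo hhi hq c F₁ F₂ F₁₀ hsplit
    hA1 hL1 hε1 hY0B₁ hY1B₁ hY0A₁ hY1A₁ hflat₁ cen hρ hA2 hF₂ hsupp₂
  rw [klpp_rowS_four_add, zero_add] at hdoor
  have hr0 : 0 ≤ klTorusNorm L (Qm - x - y) := torusSupNorm_nonneg _
  have hA0 : 0 ≤ A := (norm_nonneg _).trans (hAb 0 0 (by norm_num))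
  have hdA : 0 < B.Dtmin - 4 * A := by linarith only [hA]
  have hnβ : n ≤ nScales β := by omega
  have hGfr : 0 ≤ R.Gfr 1 := hR 1
  have hG0 : 0 ≤ (4 + 8 / 3 * R.Gfr 1 * U ^ 2) := by nlinarith [sq_nonneg U]
  have hG4 : 4 ≤ (4 + 8 / 3 * R.Gfr 1 * U ^ 2) := by nlinarith [sq_nonneg U]
  have hrΛ : klTorusNorm L (Qm - x - y) ≤ klScale klE0 (n + 1) := by
    have h4 := mul_le_mul_of_nonneg_right hG4 hr0
    linarith only [hq, h4, klth_klScale_pos (n + 1)]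
  have hsm : |-(2 * π / β)| = 2 * π / β := by rw [abs_neg, abs_of_pos (by positivity)]
  have hsp : |2 * π / β| = 2 * π / β := abs_of_pos (by positivity)
  have hA0' : (0 : ℝ) ≤ ‖c‖ + A₁ := by positivity
  have h1m := pinned_row_le_slots_shiftS₀ (L := L) (β := β) (G := (4 + 8 / 3 * R.Gfr 1 * U ^ 2)) hdA hA0 hG0 hA0' hL1 hβ hnβ hr0 hrΛ hsm
  have h1p := pinned_row_le_slots_shiftS₀ (L := L) (β := β) (G := (4 + 8 / 3 * R.Gfr 1 * U ^ 2)) hdA hA0 hG0 hA0' hL1 hβ hnβ hr0 hrΛ hsp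
  have e5 : (P.Klam * U) ^ 2 * (zX * ((4 : ℝ) ^ (n + 1))⁻¹ + hX * ((4 : ℝ) ^ (nScales β - n))⁻¹ + wX * ((2 : ℝ) ^ n)⁻¹ + lX * ((L : ℝ))⁻¹ + tX * min (klTorusNorm L (Qm - x - y) / klScale klE0 (n + 1)) (klScale klE0 (n + 1) / klTorusNorm L (Qm - x - y))) =
      (P.Klam * U) ^ 2 * zX * ((4 : ℝ) ^ (n + 1))⁻¹ + (P.Klam * U) ^ 2 * hX * ((4 : ℝ) ^ (nScales β - n))⁻¹ + (P.Klam * U) ^ 2 * wX * ((2 : ℝ) ^ n)⁻¹ +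
        (P.Klam * U) ^ 2 * lX * ((L : ℝ))⁻¹ + (P.Klam * U) ^ 2 * tX * min (klTorusNorm L (Qm - x - y) / klScale klE0 (n + 1)) (klScale klE0 (n + 1) / klTorusNorm L (Qm - x - y)) := by ring
  rw [e5]
  have eW : A₂ * (1024 * 15381) * (ρ / π + ((L : ℝ))⁻¹) = A₂ * (1024 * 15381) * (ρ / π) + A₂ * (1024 * 15381) * ((L : ℝ))⁻¹ := by ring
  linarith only [hdoor, h1m, h1p, hz, hh, hw, hl, htt, eW]

end AdapterAll

end Summit.HubbardSuperconductivity.HubbardSuperconductivity.Theorems.KLRegimeSplit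

end
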